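import Summits.QuantumFields.BalabanUV.Beta.GAN24.CombT2DriftEvenEnd
import Summits.QuantumFields.BalabanUV.Beta.GAN24.CombT2ShapeEvenEndRows
import Summits.QuantumFields.BalabanUV.Beta.GAN24.T2DriftEvenEndRows

/-!
# `BalabanUV.Beta.GAN24.CombT2DriftEvenEndRows` — binder row G-an2-4 ∕ (CONV-C), TRANSFER-III (the (α-0) chain at row D1's literal of record (III′)), link L8b′ ∕ L8c′:
# **THE «T2Drift^ε» END FOR THE COMB-CHART `T₂` TOWER WITH THE RELATIVE SOURCE's ROWS DISCHARGED INTO THE CELL CURRENCY — `hy hb hZ hbd` of the OWNER gan24-p1 g46's T5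
# `CombT2DriftEvenEnd.rate_halfMember_comb_three_of_relSource_rows` ⟸ the source rows `Hb ∕ Hbd` (W4's spelling), the cell rows `hcell ∕ hcelld` (leaf-03 g79 ∕ g80's
# (C-6) ∕ (C-6d) `CombHalfMemberCell(Drift)OfDivergences`' conclusions at `Z l := y′_l`) and the charge row `hC` (T5's `hZ`.2)** — «T2Shape^ε» `hy` by MY `CombT2ShapeEvenEndRows`
# (the T4 twin), the covariance half of `hZ` by leaf-03 g81 W2's `halfSource_comb_translate ∕ halfMember_comb_translate` ⨾ `lin4_translate` ⨾ `add ∕ sub_translate_pi`, the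
# relative source's one-step DRIFT by the OWNER's generic §0 `locStencil₂_halfTable_sub ∕ locStencil₂_sub_add_sub` on `Hbd` + `hcelld` merged at `max θb θc`; the (III′) twin of
# the OWNER gan24-p1 g34's (E) `T2DriftEvenEndRows.rate_halfMember_three_of_rows` (there the source rows came from p2's F4 via (hS, hSall); here `Hb ∕ Hbd` are displayed —
# road-P2's (III′) source-row socket), typed as a COURTESY twin by the crew's kept leaf prover (G-an2-4 CRUX TEAM (2), leaf prover `b2b-balaban-gan24-formalise-leaf-01`,
# gen 82; credit: the OWNER's (E) text token for token; the OWNER at first refusal on the bytes (journal W-2 ∕ INTENT-6); no existing file touched)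

NOT IN PRINT; OUR BOOKKEEPING ([folklore] composition BY NAME; 0 `def`, 0 cited facts, 0 `def … : Prop`, 0 sorry).  HONEST FRAMING (cell contract, verbatim): «discharging
`BetaPertH` makes Bałaban's UV stability UNCONDITIONAL — a real constructive-QFT result; it is NOT the continuum limit and NOT the Clay problem.»  HONEST DEPENDENCY (verbatim):
«continuum YM on T⁴ ⇐ BetaPertH ∧ nine spine estimates (0/9 proved); BetaPertH ⇐ (D1) ∧ (D4) ∧ CAP+tail; G-an2-4 gates asym, D1 and NE2/3/4.»

WHAT (`d = 3`, `2 ≤ Lc`, the EXACT pin `cE₂ = +Lc⁸`, `|ε| ≤ 1`, any `tabs : SymTables 3 Lc` with off-diagonal border (`hBff hBmm`; its `LocStencil₂` class and covariance are the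
record's `tabs.hB ∕ tabs.hBt`), any `cE cVH cΛ cB Tc`; objects as in `CombT2ShapeEvenEndRows`):
**`rate_halfMember_comb_three_of_rows`** — T5's conclusion VERBATIM («T2Drift^ε» at (III′): `∃ c ϑ δ, 0 ≤ c ∧ 0 < ϑ < 1 ∧ 0 < δ ∧` one-step rate `LocStencil₂ (y′_{n+1} − y′_n)
(c·ϑ^n) δ` `∧` Cauchy form `LocStencil₂ (y′_{k+j} − y′_k) (c·(1−ϑ)⁻¹·ϑ^k) δ`) from the DISPLAYED rows `Hb : ∀ l, LocStencil₂ (b̃′♮_l) Cb δb`, `Hbd : ∀ l, LocStencil₂ (b̃′♮_{l+1} −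
b̃′♮_l) (cb·θb^l) δb`, `hcell : ∀ l, LocStencil₂ (cell′^ε_l) Ccl δcl`, `hcelld : ∀ l, LocStencil₂ (cell′^ε_{l+1} − cell′^ε_l) (Ccd·θc^l) δcd`, `hC` (the zmode row of `b′^{rel,ε}_l`).
WHAT THIS IS NOT.  The five rows are DISPLAYED (their (III′) suppliers: road-P2's source-row socket; leaf-03's (C-6) ∕ (C-6d) ⟸ the eight divergence letter rows; (C) at the comb
data); asserts NO value of any charge; NOT one W-slot row, NOT the capstone; the (III′) campaign is NOT asked (an2 W-4 l.64553); NEVER «G-an2-4 closed» as (CONV-C); NOT D1, NOT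
`BetaPertH`, NOT continuum, NOT Clay; not in print.  2026-08-25.
-/

noncomputable section

open Finset
open scoped BigOperators
open Literature.MathematicalPhysics.QuantumFieldTheory
open Literature.MathematicalPhysics.QuantumFieldTheory.Balaban1983to89
open Literature.MathematicalPhysics.QuantumFieldTheory.Balaban1983to89.Beta
open ExpKernelCalculus (MKer shiftK)
open OneStepResolventKernel (Fib LocStencil)
open OneStepKernelFamily (KInvStep)
open SecondOrderResponse (W2SymOfK)
open BalabanCompositeJets (LocStencil₂ LocStencil₂.mono LocStencil₂.nonneg)
open BalabanStepJetsSucc (mmRead)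
open BalabanStepW2 (K3OfK M2Of)
open Summit.QuantumFields.BalabanUV.Beta.TameKernelCalculus (trK)
open Summit.QuantumFields.BalabanUV.Beta.BorderedHessian (sgnK)
open Summit.QuantumFields.BalabanUV.Beta.HessKerDressedUnits (unitK unitS)
open Summit.QuantumFields.BalabanUV.Beta.SecondOrderUnits (unitM unitS₂ unitM₂)
open Summit.QuantumFields.BalabanUV.Beta.SpineRooted (T2RecOf)
open Summit.QuantumFields.BalabanUV.Beta.SymmetrisedStepJets (SymTables)
open Summit.QuantumFields.BalabanUV.Beta.CombChartStepJets (GcombSh SpureCombOf)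
open Summit.QuantumFields.BalabanUV.Beta.GAN24.CombesThomas (sfStep smStep)
open Summit.QuantumFields.BalabanUV.Beta.GAN24.T2RecursionAffine (lin4)
open Summit.QuantumFields.BalabanUV.Beta.GAN24.BiStencilZeroMode (zmode)
open Summit.QuantumFields.BalabanUV.Beta.GAN24.WSlotT2OfPieces (locStencil₂_add)
open Summit.QuantumFields.BalabanUV.Beta.GAN24.WSlotCauchyOfShapes (locStencil₂_le_mono mul_pow_le_mul_pow)
open Summit.QuantumFields.BalabanUV.Beta.GAN24.WSlotForcingZeroModeW3 (add_translate_pi sub_translate_pi)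
open Summit.QuantumFields.BalabanUV.Beta.GAN24.Lin4ZeroMode (lin4_translate shiftK_unitKInvStep)
open Summit.QuantumFields.BalabanUV.Beta.GAN24.T2ShapeEvenEnd (locStencil₂_halfTable)
open Summit.QuantumFields.BalabanUV.Beta.GAN24.T2DriftEvenEndRows (locStencil₂_halfTable_sub locStencil₂_sub_add_sub)
open Summit.QuantumFields.BalabanUV.Beta.GAN24.CombT2DriftEvenEnd (rate_halfMember_comb_three_of_relSource_rows)
open Summit.QuantumFields.BalabanUV.Beta.GAN24.CombT2ShapeEvenEndRows (locStencil₂_halfMember_comb_three_of_rows)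
open Summit.QuantumFields.BalabanUV.Beta.GAN24.CombLegTowerWindowSources (shiftK_unitK_GcombSh)
open Summit.QuantumFields.BalabanUV.Beta.GAN24.CombLegSourceRuledClass (halfSource_comb_translate halfMember_comb_translate)

namespace Summit.QuantumFields.BalabanUV.Beta.GAN24.CombT2DriftEvenEndRows

variable {Lc : ℕ} [NeZero Lc]

/-- NOT IN PRINT; OUR BOOKKEEPING.  **«T2Drift^ε» AT (III′) WITH THE RELATIVE SOURCE's ROWS DISCHARGED INTO `Hb Hbd ∕ hcell hcelld ∕ hC`** (`d = 3`, `2 ≤ Lc`, exact pin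
`cE₂ = +Lc⁸`, `|ε| ≤ 1`, any sym record with off-diagonal border): the OWNER's T5 socket with `hy` := MY `CombT2ShapeEvenEndRows.locStencil₂_halfMember_comb_three_of_rows` (border
class `tabs.hB`), `hb := ½•(Hb + ε•P Hb) + hcell`, `hZ := ⟨covariance, hC l⟩`, `hbd := ½•(Hbd + ε•P Hbd) + hcelld` at `max θb θc` (`locStencil₂_halfTable_sub ∕ locStencil₂_sub_add_sub ∕
mul_pow_le_mul_pow`).  The (III′) twin of the OWNER gan24-p1 g34's `T2DriftEvenEndRows.rate_halfMember_three_of_rows` (COURTESY; credit the OWNER). -/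
theorem rate_halfMember_comb_three_of_rows (hLc : 2 ≤ Lc) (tabs : SymTables 3 Lc) (cE cVH cΛ cE₂ cB : ℝ)
    (hpinEq : cE₂ = (Lc : ℝ) ^ (2 * (3 + 1))) (Tc : Fin 4 → Fin 4 → Fin 4 → Fin 4 → ℝ)
    (hBff : ∀ κ u κ' u' x z (α β : Fin (3 + 1)), tabs.vh₂S κ u κ' u' x z (Sum.inl α) (Sum.inl β) = 0)
    (hBmm : ∀ κ u κ' u' x z (μ ν : Fin (3 + 1)), tabs.vh₂S κ u κ' u' x z (Sum.inr μ) (Sum.inr ν) = 0)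
    (ε : ℝ) (hε : |ε| ≤ 1) {Cb δb cb θb : ℝ}
    (Hb : ∀ l : ℕ, LocStencil₂ (fun κ u κ' u' => (cE₂ * (Lc : ℝ) ^ (2 * (3 + 1))) • mmRead Lc (K3OfK (unitK (sfStep Lc l) (smStep 3 Lc l) (GcombSh (d := 3) Lc l)) Lc (unitS (sfStep Lc l) (smStep 3 Lc l) (SpureCombOf tabs cE cVH cΛ l)) (unitM (sfStep Lc l) (smStep 3 Lc l) (tabs.M l)) (W2SymOfK (unitK (sfStep Lc l) (smStep 3 Lc l) (GcombSh (d := 3) Lc l)) Lc (unitS (sfStep Lc l) (smStep 3 Lc l) (SpureCombOf tabs cE cVH cΛ l)) (unitM (sfStep Lc l) (smStep 3 Lc l) (tabs.M l)) 0 (unitM₂ (sfStep Lc l) (smStep 3 Lc l) (M2Of 3 Lc tabs.mixFF l))) κ u κ' u') + cB • tabs.vh₂S κ u κ' u') Cb δb)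
    (hδb : 0 < δb)
    (Hbd : ∀ l : ℕ, LocStencil₂ ((fun κ u κ' u' => (cE₂ * (Lc : ℝ) ^ (2 * (3 + 1))) • mmRead Lc (K3OfK (unitK (sfStep Lc (l + 1)) (smStep 3 Lc (l + 1)) (GcombSh (d := 3) Lc (l + 1))) Lc (unitS (sfStep Lc (l + 1)) (smStep 3 Lc (l + 1)) (SpureCombOf tabs cE cVH cΛ (l + 1))) (unitM (sfStep Lc (l + 1)) (smStep 3 Lc (l + 1)) (tabs.M (l + 1))) (W2SymOfK (unitK (sfStep Lc (l + 1)) (smStep 3 Lc (l + 1)) (GcombSh (d := 3) Lc (l + 1))) Lc (unitS (sfStep Lc (l + 1)) (smStep 3 Lc (l + 1)) (SpureCombOf tabs cE cVH cΛ (l + 1))) (unitM (sfStep Lc (l + 1)) (smStep 3 Lc (l + 1)) (tabs.M (l + 1))) 0 (unitM₂ (sfStep Lc (l + 1)) (smStep 3 Lc (l + 1)) (M2Of 3 Lc tabs.mixFF (l + 1)))) κ u κ' u') + cB • tabs.vh₂S κ u κ' u')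
      - (fun κ u κ' u' => (cE₂ * (Lc : ℝ) ^ (2 * (3 + 1))) • mmRead Lc (K3OfK (unitK (sfStep Lc l) (smStep 3 Lc l) (GcombSh (d := 3) Lc l)) Lc (unitS (sfStep Lc l) (smStep 3 Lc l) (SpureCombOf tabs cE cVH cΛ l)) (unitM (sfStep Lc l) (smStep 3 Lc l) (tabs.M l)) (W2SymOfK (unitK (sfStep Lc l) (smStep 3 Lc l) (GcombSh (d := 3) Lc l)) Lc (unitS (sfStep Lc l) (smStep 3 Lc l) (SpureCombOf tabs cE cVH cΛ l)) (unitM (sfStep Lc l) (smStep 3 Lc l) (tabs.M l)) 0 (unitM₂ (sfStep Lc l) (smStep 3 Lc l) (M2Of 3 Lc tabs.mixFF l))) κ u κ' u') + cB • tabs.vh₂S κ u κ' u')) (cb * θb ^ l) δb)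
    (hθb0 : 0 ≤ θb) (hθb1 : θb < 1) {Ccl δcl Ccd θc δcd : ℝ}
    (hcell : ∀ l : ℕ, LocStencil₂
      (lin4 (cE₂ * (Lc : ℝ) ^ (2 * (3 + 1))) (unitK (sfStep Lc l) (smStep 3 Lc l) (GcombSh (d := 3) Lc l)) Lc (((1 : ℝ) / 2) • (unitS₂ (sfStep Lc l) (smStep 3 Lc l) (T2RecOf 3 Lc (GcombSh Lc) (SpureCombOf tabs cE cVH cΛ) tabs.M cE₂ cB Tc tabs.vh₂S tabs.mixFF l) + ε • fun κ u κ' u' => sgnK (trK ((unitS₂ (sfStep Lc l) (smStep 3 Lc l) (T2RecOf 3 Lc (GcombSh Lc) (SpureCombOf tabs cE cVH cΛ) tabs.M cE₂ cB Tc tabs.vh₂S tabs.mixFF l)) κ u κ' u'))))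
          - lin4 (cE₂ * (Lc : ℝ) ^ (2 * (3 + 1))) (unitK (sfStep Lc l) (smStep 3 Lc l) (KInvStep (d := 3) Lc l)) Lc (((1 : ℝ) / 2) • (unitS₂ (sfStep Lc l) (smStep 3 Lc l) (T2RecOf 3 Lc (GcombSh Lc) (SpureCombOf tabs cE cVH cΛ) tabs.M cE₂ cB Tc tabs.vh₂S tabs.mixFF l) + ε • fun κ u κ' u' => sgnK (trK ((unitS₂ (sfStep Lc l) (smStep 3 Lc l) (T2RecOf 3 Lc (GcombSh Lc) (SpureCombOf tabs cE cVH cΛ) tabs.M cE₂ cB Tc tabs.vh₂S tabs.mixFF l)) κ u κ' u'))))) Ccl δcl)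
    (hδcl : 0 < δcl)
    (hcelld : ∀ l : ℕ, LocStencil₂
      ((lin4 (cE₂ * (Lc : ℝ) ^ (2 * (3 + 1))) (unitK (sfStep Lc (l + 1)) (smStep 3 Lc (l + 1)) (GcombSh (d := 3) Lc (l + 1))) Lc (((1 : ℝ) / 2) • (unitS₂ (sfStep Lc (l + 1)) (smStep 3 Lc (l + 1)) (T2RecOf 3 Lc (GcombSh Lc) (SpureCombOf tabs cE cVH cΛ) tabs.M cE₂ cB Tc tabs.vh₂S tabs.mixFF (l + 1)) + ε • fun κ u κ' u' => sgnK (trK ((unitS₂ (sfStep Lc (l + 1)) (smStep 3 Lc (l + 1)) (T2RecOf 3 Lc (GcombSh Lc) (SpureCombOf tabs cE cVH cΛ) tabs.M cE₂ cB Tc tabs.vh₂S tabs.mixFF (l + 1))) κ u κ' u'))))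
          - lin4 (cE₂ * (Lc : ℝ) ^ (2 * (3 + 1))) (unitK (sfStep Lc (l + 1)) (smStep 3 Lc (l + 1)) (KInvStep (d := 3) Lc (l + 1))) Lc (((1 : ℝ) / 2) • (unitS₂ (sfStep Lc (l + 1)) (smStep 3 Lc (l + 1)) (T2RecOf 3 Lc (GcombSh Lc) (SpureCombOf tabs cE cVH cΛ) tabs.M cE₂ cB Tc tabs.vh₂S tabs.mixFF (l + 1)) + ε • fun κ u κ' u' => sgnK (trK ((unitS₂ (sfStep Lc (l + 1)) (smStep 3 Lc (l + 1)) (T2RecOf 3 Lc (GcombSh Lc) (SpureCombOf tabs cE cVH cΛ) tabs.M cE₂ cB Tc tabs.vh₂S tabs.mixFF (l + 1))) κ u κ' u')))))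
       - (lin4 (cE₂ * (Lc : ℝ) ^ (2 * (3 + 1))) (unitK (sfStep Lc l) (smStep 3 Lc l) (GcombSh (d := 3) Lc l)) Lc (((1 : ℝ) / 2) • (unitS₂ (sfStep Lc l) (smStep 3 Lc l) (T2RecOf 3 Lc (GcombSh Lc) (SpureCombOf tabs cE cVH cΛ) tabs.M cE₂ cB Tc tabs.vh₂S tabs.mixFF l) + ε • fun κ u κ' u' => sgnK (trK ((unitS₂ (sfStep Lc l) (smStep 3 Lc l) (T2RecOf 3 Lc (GcombSh Lc) (SpureCombOf tabs cE cVH cΛ) tabs.M cE₂ cB Tc tabs.vh₂S tabs.mixFF l)) κ u κ' u'))))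
          - lin4 (cE₂ * (Lc : ℝ) ^ (2 * (3 + 1))) (unitK (sfStep Lc l) (smStep 3 Lc l) (KInvStep (d := 3) Lc l)) Lc (((1 : ℝ) / 2) • (unitS₂ (sfStep Lc l) (smStep 3 Lc l) (T2RecOf 3 Lc (GcombSh Lc) (SpureCombOf tabs cE cVH cΛ) tabs.M cE₂ cB Tc tabs.vh₂S tabs.mixFF l) + ε • fun κ u κ' u' => sgnK (trK ((unitS₂ (sfStep Lc l) (smStep 3 Lc l) (T2RecOf 3 Lc (GcombSh Lc) (SpureCombOf tabs cE cVH cΛ) tabs.M cE₂ cB Tc tabs.vh₂S tabs.mixFF l)) κ u κ' u')))))) (Ccd * θc ^ l) δcd)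
    (hθc0 : 0 ≤ θc) (hθc1 : θc < 1) (hδcd : 0 < δcd)
    (hC : ∀ l : ℕ, (∀ κ κ' κ₁ κ₂, zmode Lc ((((1 : ℝ) / 2) • ((fun κ u κ' u' => (cE₂ * (Lc : ℝ) ^ (2 * (3 + 1))) • mmRead Lc (K3OfK (unitK (sfStep Lc l) (smStep 3 Lc l) (GcombSh (d := 3) Lc l)) Lc (unitS (sfStep Lc l) (smStep 3 Lc l) (SpureCombOf tabs cE cVH cΛ l)) (unitM (sfStep Lc l) (smStep 3 Lc l) (tabs.M l)) (W2SymOfK (unitK (sfStep Lc l) (smStep 3 Lc l) (GcombSh (d := 3) Lc l)) Lc (unitS (sfStep Lc l) (smStep 3 Lc l) (SpureCombOf tabs cE cVH cΛ l)) (unitM (sfStep Lc l) (smStep 3 Lc l) (tabs.M l)) 0 (unitM₂ (sfStep Lc l) (smStep 3 Lc l) (M2Of 3 Lc tabs.mixFF l))) κ u κ' u') + cB • tabs.vh₂S κ u κ' u') + ε • fun κ u κ' u' => sgnK (trK ((cE₂ * (Lc : ℝ) ^ (2 * (3 + 1))) • mmRead Lc (K3OfK (unitK (sfStep Lc l) (smStep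 3 Lc l) (GcombSh (d := 3) Lc l)) Lc (unitS (sfStep Lc l) (smStep 3 Lc l) (SpureCombOf tabs cE cVH cΛ l)) (unitM (sfStep Lc l) (smStep 3 Lc l) (tabs.M l)) (W2SymOfK (unitK (sfStep Lc l) (smStep 3 Lc l) (GcombSh (d := 3) Lc l)) Lc (unitS (sfStep Lc l) (smStep 3 Lc l) (SpureCombOf tabs cE cVH cΛ l)) (unitM (sfStep Lc l) (smStep 3 Lc l) (tabs.M l)) 0 (unitM₂ (sfStep Lc l) (smStep 3 Lc l) (M2Of 3 Lc tabs.mixFF l))) κ u κ' u') + cB • tabs.vh₂S κ u κ' u')))) +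
          (lin4 (cE₂ * (Lc : ℝ) ^ (2 * (3 + 1))) (unitK (sfStep Lc l) (smStep 3 Lc l) (GcombSh (d := 3) Lc l)) Lc (((1 : ℝ) / 2) • (unitS₂ (sfStep Lc l) (smStep 3 Lc l) (T2RecOf 3 Lc (GcombSh Lc) (SpureCombOf tabs cE cVH cΛ) tabs.M cE₂ cB Tc tabs.vh₂S tabs.mixFF l) + ε • fun κ u κ' u' => sgnK (trK ((unitS₂ (sfStep Lc l) (smStep 3 Lc l) (T2RecOf 3 Lc (GcombSh Lc) (SpureCombOf tabs cE cVH cΛ) tabs.M cE₂ cB Tc tabs.vh₂S tabs.mixFF l)) κ u κ' u'))))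
          - lin4 (cE₂ * (Lc : ℝ) ^ (2 * (3 + 1))) (unitK (sfStep Lc l) (smStep 3 Lc l) (KInvStep (d := 3) Lc l)) Lc (((1 : ℝ) / 2) • (unitS₂ (sfStep Lc l) (smStep 3 Lc l) (T2RecOf 3 Lc (GcombSh Lc) (SpureCombOf tabs cE cVH cΛ) tabs.M cE₂ cB Tc tabs.vh₂S tabs.mixFF l) + ε • fun κ u κ' u' => sgnK (trK ((unitS₂ (sfStep Lc l) (smStep 3 Lc l) (T2RecOf 3 Lc (GcombSh Lc) (SpureCombOf tabs cE cVH cΛ) tabs.M cE₂ cB Tc tabs.vh₂S tabs.mixFF l)) κ u κ' u')))))) κ κ' (Sum.inl κ₁) (Sum.inl κ₂)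
        + zmode Lc ((((1 : ℝ) / 2) • ((fun κ u κ' u' => (cE₂ * (Lc : ℝ) ^ (2 * (3 + 1))) • mmRead Lc (K3OfK (unitK (sfStep Lc l) (smStep 3 Lc l) (GcombSh (d := 3) Lc l)) Lc (unitS (sfStep Lc l) (smStep 3 Lc l) (SpureCombOf tabs cE cVH cΛ l)) (unitM (sfStep Lc l) (smStep 3 Lc l) (tabs.M l)) (W2SymOfK (unitK (sfStep Lc l) (smStep 3 Lc l) (GcombSh (d := 3) Lc l)) Lc (unitS (sfStep Lc l) (smStep 3 Lc l) (SpureCombOf tabs cE cVH cΛ l)) (unitM (sfStep Lc l) (smStep 3 Lc l) (tabs.M l)) 0 (unitM₂ (sfStep Lc l) (smStep 3 Lc l) (M2Of 3 Lc tabs.mixFF l))) κ u κ' u') + cB • tabs.vh₂S κ u κ' u') + ε • fun κ u κ' u' => sgnK (trK ((cE₂ * (Lc : ℝ) ^ (2 * (3 + 1))) • mmRead Lc (K3OfK (unitK (sfStep Lc l) (smStep 3 Lc l) (GcombSh (d := 3) Lc l)) Lc (unitS (sfStep Lc l) (smStep 3 Lc l) (SpureCombOf tabs cE cVH cΛ l))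 (unitM (sfStep Lc l) (smStep 3 Lc l) (tabs.M l)) (W2SymOfK (unitK (sfStep Lc l) (smStep 3 Lc l) (GcombSh (d := 3) Lc l)) Lc (unitS (sfStep Lc l) (smStep 3 Lc l) (SpureCombOf tabs cE cVH cΛ l)) (unitM (sfStep Lc l) (smStep 3 Lc l) (tabs.M l)) 0 (unitM₂ (sfStep Lc l) (smStep 3 Lc l) (M2Of 3 Lc tabs.mixFF l))) κ u κ' u') + cB • tabs.vh₂S κ u κ' u')))) +
          (lin4 (cE₂ * (Lc : ℝ) ^ (2 * (3 + 1))) (unitK (sfStep Lc l) (smStep 3 Lc l) (GcombSh (d := 3) Lc l)) Lc (((1 : ℝ) / 2) • (unitS₂ (sfStep Lc l) (smStep 3 Lc l) (T2RecOf 3 Lc (GcombSh Lc) (SpureCombOf tabs cE cVH cΛ) tabs.M cE₂ cB Tc tabs.vh₂S tabs.mixFF l) + ε • fun κ u κ' u' => sgnK (trK ((unitS₂ (sfStep Lc l) (smStep 3 Lc l) (T2RecOf 3 Lc (GcombSh Lc) (SpureCombOf tabs cE cVH cΛ) tabs.M cE₂ cB Tc tabs.vh₂S tabs.mixFF l)) κ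 u κ' u'))))
          - lin4 (cE₂ * (Lc : ℝ) ^ (2 * (3 + 1))) (unitK (sfStep Lc l) (smStep 3 Lc l) (KInvStep (d := 3) Lc l)) Lc (((1 : ℝ) / 2) • (unitS₂ (sfStep Lc l) (smStep 3 Lc l) (T2RecOf 3 Lc (GcombSh Lc) (SpureCombOf tabs cE cVH cΛ) tabs.M cE₂ cB Tc tabs.vh₂S tabs.mixFF l) + ε • fun κ u κ' u' => sgnK (trK ((unitS₂ (sfStep Lc l) (smStep 3 Lc l) (T2RecOf 3 Lc (GcombSh Lc) (SpureCombOf tabs cE cVH cΛ) tabs.M cE₂ cB Tc tabs.vh₂S tabs.mixFF l)) κ u κ' u')))))) κ' κ (Sum.inl κ₁) (Sum.inl κ₂) = 0)) :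
    ∃ c ϑ δ : ℝ, 0 ≤ c ∧ 0 < ϑ ∧ ϑ < 1 ∧ 0 < δ ∧
      (∀ n, LocStencil₂ ((((1 : ℝ) / 2) • (unitS₂ (sfStep Lc (n + 1)) (smStep 3 Lc (n + 1)) (T2RecOf 3 Lc (GcombSh Lc) (SpureCombOf tabs cE cVH cΛ) tabs.M cE₂ cB Tc tabs.vh₂S tabs.mixFF (n + 1)) + ε • fun κ u κ' u' => sgnK (trK ((unitS₂ (sfStep Lc (n + 1)) (smStep 3 Lc (n + 1)) (T2RecOf 3 Lc (GcombSh Lc) (SpureCombOf tabs cE cVH cΛ) tabs.M cE₂ cB Tc tabs.vh₂S tabs.mixFF (n + 1))) κ u κ' u'))))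
        - (((1 : ℝ) / 2) • (unitS₂ (sfStep Lc n) (smStep 3 Lc n) (T2RecOf 3 Lc (GcombSh Lc) (SpureCombOf tabs cE cVH cΛ) tabs.M cE₂ cB Tc tabs.vh₂S tabs.mixFF n) + ε • fun κ u κ' u' => sgnK (trK ((unitS₂ (sfStep Lc n) (smStep 3 Lc n) (T2RecOf 3 Lc (GcombSh Lc) (SpureCombOf tabs cE cVH cΛ) tabs.M cE₂ cB Tc tabs.vh₂S tabs.mixFF n)) κ u κ' u'))))) (c * ϑ ^ n) δ) ∧
      (∀ k j, LocStencil₂ ((((1 : ℝ) / 2) • (unitS₂ (sfStep Lc (k + j)) (smStep 3 Lc (k + j)) (T2RecOf 3 Lc (GcombSh Lc) (SpureCombOf tabs cE cVH cΛ) tabs.M cE₂ cB Tc tabs.vh₂S tabs.mixFF (k + j)) + ε • fun κ u κ' u' => sgnK (trK ((unitS₂ (sfStep Lc (k + j)) (smStep 3 Lc (k + j)) (T2RecOf 3 Lc (GcombSh Lc) (SpureCombOf tabs cE cVH cΛ) tabs.M cE₂ cB Tc tabs.vh₂S tabs.mixFF (k + j))) κ u κ' u'))))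
        - (((1 : ℝ) / 2) • (unitS₂ (sfStep Lc k) (smStep 3 Lc k) (T2RecOf 3 Lc (GcombSh Lc) (SpureCombOf tabs cE cVH cΛ) tabs.M cE₂ cB Tc tabs.vh₂S tabs.mixFF k) + ε • fun κ u κ' u' => sgnK (trK ((unitS₂ (sfStep Lc k) (smStep 3 Lc k) (T2RecOf 3 Lc (GcombSh Lc) (SpureCombOf tabs cE cVH cΛ) tabs.M cE₂ cB Tc tabs.vh₂S tabs.mixFF k)) κ u κ' u'))))) (c * (1 - ϑ)⁻¹ * ϑ ^ k) δ) := by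
  have hpin : |cE₂| ≤ (Lc : ℝ) ^ (2 * (3 + 1)) := by
    rw [hpinEq, abs_of_nonneg (by positivity)]
  obtain ⟨CB, δB, hδB, hB⟩ := tabs.hB
  -- «T2Shape^ε» by MY T4-rows twin (same displayed rows `Hb`, `hcell`, `hC`)
  obtain ⟨Cy, δy, hδy, hy⟩ := locStencil₂_halfMember_comb_three_of_rows hLc tabs cE cVH cΛ cE₂ cB hpin Tc hBff hBmm hB hδB ε hε Hb hδb hcell hδcl hC
  have hm : 0 < min δb δcl := lt_min hδb hδcl
  have hcb : 0 ≤ cb := by simpa using (Hbd 0).nonneg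
  have hCcd : 0 ≤ Ccd := by simpa using (hcelld 0).nonneg
  -- the member's joint covariance (the OWNER's T5 §1 ⨾ `covariant_half`, leaf-03 g81 W2)
  have hY : ∀ (l : ℕ) (κ : Fin (3 + 1)) (u : Fin (3 + 1) → ℤ) (κ' : Fin (3 + 1)) (u' t : Fin (3 + 1) → ℤ),
      (((1 : ℝ) / 2) • (unitS₂ (sfStep Lc l) (smStep 3 Lc l) (T2RecOf 3 Lc (GcombSh Lc) (SpureCombOf tabs cE cVH cΛ) tabs.M cE₂ cB Tc tabs.vh₂S tabs.mixFF l) + ε • fun κ u κ' u' => sgnK (trK ((unitS₂ (sfStep Lc l) (smStep 3 Lc l) (T2RecOf 3 Lc (GcombSh Lc) (SpureCombOf tabs cE cVH cΛ) tabs.M cE₂ cB Tc tabs.vh₂S tabs.mixFF l)) κ u κ' u')))) κ (u + (Lc : ℤ) • t) κ' (u' + (Lc : ℤ) • t)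
        = shiftK (-((Lc : ℤ) • t)) ((((1 : ℝ) / 2) • (unitS₂ (sfStep Lc l) (smStep 3 Lc l) (T2RecOf 3 Lc (GcombSh Lc) (SpureCombOf tabs cE cVH cΛ) tabs.M cE₂ cB Tc tabs.vh₂S tabs.mixFF l) + ε • fun κ u κ' u' => sgnK (trK ((unitS₂ (sfStep Lc l) (smStep 3 Lc l) (T2RecOf 3 Lc (GcombSh Lc) (SpureCombOf tabs cE cVH cΛ) tabs.M cE₂ cB Tc tabs.vh₂S tabs.mixFF l)) κ u κ' u')))) κ u κ' u') :=
    fun l κ u κ' u' t => halfMember_comb_translate tabs cE cVH cΛ cE₂ cB Tc ε l κ u κ' u' t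
  -- the relative source's one-step DRIFT: source half (`Hbd` ⨾ §0) + the cells' drift, merged at one geometric rate
  have hbd : ∀ l, LocStencil₂ (((((1 : ℝ) / 2) • ((fun κ u κ' u' => (cE₂ * (Lc : ℝ) ^ (2 * (3 + 1))) • mmRead Lc (K3OfK (unitK (sfStep Lc (l + 1)) (smStep 3 Lc (l + 1)) (GcombSh (d := 3) Lc (l + 1))) Lc (unitS (sfStep Lc (l + 1)) (smStep 3 Lc (l + 1)) (SpureCombOf tabs cE cVH cΛ (l + 1))) (unitM (sfStep Lc (l + 1)) (smStep 3 Lc (l + 1)) (tabs.M (l + 1))) (W2SymOfK (unitK (sfStep Lc (l + 1)) (smStep 3 Lc (l + 1)) (GcombSh (d := 3) Lc (l + 1))) Lc (unitS (sfStep Lc (l + 1)) (smStep 3 Lc (l + 1)) (SpureCombOf tabs cE cVH cΛ (l + 1))) (unitM (sfStep Lc (l + 1)) (smStep 3 Lc (l + 1)) (tabs.M (l + 1))) 0 (unitM₂ (sfStep Lc (l + 1)) (smStep 3 Lc (l + 1)) (M2Of 3 Lc tabs.mixFF (l + 1)))) κ u κ' u') + cB • tabs.vh₂S κ u κ' u')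 + ε • fun κ u κ' u' => sgnK (trK ((cE₂ * (Lc : ℝ) ^ (2 * (3 + 1))) • mmRead Lc (K3OfK (unitK (sfStep Lc (l + 1)) (smStep 3 Lc (l + 1)) (GcombSh (d := 3) Lc (l + 1))) Lc (unitS (sfStep Lc (l + 1)) (smStep 3 Lc (l + 1)) (SpureCombOf tabs cE cVH cΛ (l + 1))) (unitM (sfStep Lc (l + 1)) (smStep 3 Lc (l + 1)) (tabs.M (l + 1))) (W2SymOfK (unitK (sfStep Lc (l + 1)) (smStep 3 Lc (l + 1)) (GcombSh (d := 3) Lc (l + 1))) Lc (unitS (sfStep Lc (l + 1)) (smStep 3 Lc (l + 1)) (SpureCombOf tabs cE cVH cΛ (l + 1))) (unitM (sfStep Lc (l + 1)) (smStep 3 Lc (l + 1)) (tabs.M (l + 1))) 0 (unitM₂ (sfStep Lc (l + 1)) (smStep 3 Lc (l + 1)) (M2Of 3 Lc tabs.mixFF (l + 1)))) κ u κ' u') + cB • tabs.vh₂S κ u κ' u')))) +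
          (lin4 (cE₂ * (Lc : ℝ) ^ (2 * (3 + 1))) (unitK (sfStep Lc (l + 1)) (smStep 3 Lc (l + 1)) (GcombSh (d := 3) Lc (l + 1))) Lc (((1 : ℝ) / 2) • (unitS₂ (sfStep Lc (l + 1)) (smStep 3 Lc (l + 1)) (T2RecOf 3 Lc (GcombSh Lc) (SpureCombOf tabs cE cVH cΛ) tabs.M cE₂ cB Tc tabs.vh₂S tabs.mixFF (l + 1)) + ε • fun κ u κ' u' => sgnK (trK ((unitS₂ (sfStep Lc (l + 1)) (smStep 3 Lc (l + 1)) (T2RecOf 3 Lc (GcombSh Lc) (SpureCombOf tabs cE cVH cΛ) tabs.M cE₂ cB Tc tabs.vh₂S tabs.mixFF (l + 1))) κ u κ' u'))))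
          - lin4 (cE₂ * (Lc : ℝ) ^ (2 * (3 + 1))) (unitK (sfStep Lc (l + 1)) (smStep 3 Lc (l + 1)) (KInvStep (d := 3) Lc (l + 1))) Lc (((1 : ℝ) / 2) • (unitS₂ (sfStep Lc (l + 1)) (smStep 3 Lc (l + 1)) (T2RecOf 3 Lc (GcombSh Lc) (SpureCombOf tabs cE cVH cΛ) tabs.M cE₂ cB Tc tabs.vh₂S tabs.mixFF (l + 1)) + ε • fun κ u κ' u' => sgnK (trK ((unitS₂ (sfStep Lc (l + 1)) (smStep 3 Lc (l + 1)) (T2RecOf 3 Lc (GcombSh Lc) (SpureCombOf tabs cE cVH cΛ) tabs.M cE₂ cB Tc tabs.vh₂S tabs.mixFF (l + 1))) κ u κ' u'))))))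
      - ((((1 : ℝ) / 2) • ((fun κ u κ' u' => (cE₂ * (Lc : ℝ) ^ (2 * (3 + 1))) • mmRead Lc (K3OfK (unitK (sfStep Lc l) (smStep 3 Lc l) (GcombSh (d := 3) Lc l)) Lc (unitS (sfStep Lc l) (smStep 3 Lc l) (SpureCombOf tabs cE cVH cΛ l)) (unitM (sfStep Lc l) (smStep 3 Lc l) (tabs.M l)) (W2SymOfK (unitK (sfStep Lc l) (smStep 3 Lc l) (GcombSh (d := 3) Lc l)) Lc (unitS (sfStep Lc l) (smStep 3 Lc l) (SpureCombOf tabs cE cVH cΛ l)) (unitM (sfStep Lc l) (smStep 3 Lc l) (tabs.M l)) 0 (unitM₂ (sfStep Lc l) (smStep 3 Lc l) (M2Of 3 Lc tabs.mixFF l))) κ u κ' u') + cB • tabs.vh₂S κ u κ' u') + ε • fun κ u κ' u' => sgnK (trK ((cE₂ * (Lc : ℝ) ^ (2 * (3 + 1))) • mmRead Lc (K3OfK (unitK (sfStep Lc l) (smStep 3 Lc l) (GcombSh (d := 3) Lc l)) Lc (unitS (sfStep Lc l) (smStep 3 Lc l) (SpureCombOf tabs cE cVH cΛ l)) (unitM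 (sfStep Lc l) (smStep 3 Lc l) (tabs.M l)) (W2SymOfK (unitK (sfStep Lc l) (smStep 3 Lc l) (GcombSh (d := 3) Lc l)) Lc (unitS (sfStep Lc l) (smStep 3 Lc l) (SpureCombOf tabs cE cVH cΛ l)) (unitM (sfStep Lc l) (smStep 3 Lc l) (tabs.M l)) 0 (unitM₂ (sfStep Lc l) (smStep 3 Lc l) (M2Of 3 Lc tabs.mixFF l))) κ u κ' u') + cB • tabs.vh₂S κ u κ' u')))) +
          (lin4 (cE₂ * (Lc : ℝ) ^ (2 * (3 + 1))) (unitK (sfStep Lc l) (smStep 3 Lc l) (GcombSh (d := 3) Lc l)) Lc (((1 : ℝ) / 2) • (unitS₂ (sfStep Lc l) (smStep 3 Lc l) (T2RecOf 3 Lc (GcombSh Lc) (SpureCombOf tabs cE cVH cΛ) tabs.M cE₂ cB Tc tabs.vh₂S tabs.mixFF l) + ε • fun κ u κ' u' => sgnK (trK ((unitS₂ (sfStep Lc l) (smStep 3 Lc l) (T2RecOf 3 Lc (GcombSh Lc) (SpureCombOf tabs cE cVH cΛ) tabs.M cE₂ cB Tc tabs.vh₂S tabs.mixFF l)) κ u κ'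 u'))))
          - lin4 (cE₂ * (Lc : ℝ) ^ (2 * (3 + 1))) (unitK (sfStep Lc l) (smStep 3 Lc l) (KInvStep (d := 3) Lc l)) Lc (((1 : ℝ) / 2) • (unitS₂ (sfStep Lc l) (smStep 3 Lc l) (T2RecOf 3 Lc (GcombSh Lc) (SpureCombOf tabs cE cVH cΛ) tabs.M cE₂ cB Tc tabs.vh₂S tabs.mixFF l) + ε • fun κ u κ' u' => sgnK (trK ((unitS₂ (sfStep Lc l) (smStep 3 Lc l) (T2RecOf 3 Lc (GcombSh Lc) (SpureCombOf tabs cE cVH cΛ) tabs.M cE₂ cB Tc tabs.vh₂S tabs.mixFF l)) κ u κ' u'))))))) ((cb + Ccd) * (max θb θc) ^ l) (min δb δcd) := by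
    intro l
    have h := locStencil₂_sub_add_sub
      (locStencil₂_le_mono (locStencil₂_halfTable_sub (Hbd l) hε) (mul_pow_le_mul_pow hcb hθb0 (le_max_left θb θc) l) (min_le_left δb δcd))
      (locStencil₂_le_mono (hcelld l) (mul_pow_le_mul_pow hCcd hθc0 (le_max_right θb θc) l) (min_le_right δb δcd))
    rw [← add_mul] at h
    exact h
  exact rate_halfMember_comb_three_of_relSource_rows hLc tabs cE cVH cΛ cE₂ cB hpinEq Tc hBff hBmm ε hy hδy
    (fun l => locStencil₂_add ((locStencil₂_halfTable (Hb l) hε).mono (min_le_left _ _)) ((hcell l).mono (min_le_right _ _))) hm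
    (fun l => ⟨fun κ u κ' u' t => add_translate_pi (w := (Lc : ℤ) • t) (v := -((Lc : ℤ) • t))
        (fun κ u κ' u' => halfSource_comb_translate tabs cE cVH cΛ cE₂ cB Tc hBff hBmm ε l κ u κ' u' t)
        (sub_translate_pi (w := (Lc : ℤ) • t) (v := -((Lc : ℤ) • t))
          (fun κ u κ' u' => lin4_translate (shiftK_unitK_GcombSh (d := 3) (Lc := Lc) l) _ (hY l) κ u κ' u' ((Lc : ℤ) • t))
          (fun κ u κ' u' => lin4_translate (shiftK_unitKInvStep (d := 3) (Lc := Lc) l) _ (hY l) κ u κ' u' ((Lc : ℤ) • t)))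
        κ u κ' u', hC l⟩)
    hbd (hθb0.trans (le_max_left _ _)) (max_lt hθb1 hθc1) (lt_min hδb hδcd)

end Summit.QuantumFields.BalabanUV.Beta.GAN24.CombT2DriftEvenEndRows

end
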